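import Summits.QuantumFields.BalabanUV.T4Continuum.Support.TermwiseHolder

/-!
# TermwiseHolder (part 2/4) — `U(N)` Wilson terms with an `ℓ²` oscillation profile: `dUP`, the producer, the
ledger theorem

HONEST FRAMING, PLACEMENT, ABSOLUTE RULE: see part 1/4 (`Support/TermwiseHolder`), whose module docstring governs
this file verbatim: FIXED FINITE four-torus, rung (B)+1, conditional; NOT infinite volume, NOT a mass gap, NOT the
Clay statement; the spine estimate NE7 is NOT PRINTED in [Balaban1984PropagatorsI]–[Balaban1989LargeFieldII] and NOT
proved here; no sentence of print is quoted; every hypothesis is a NAMED binder.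

Contents: §4 the (U)-majorant `dUP N L n c_α c_{α1} ε₁ h K = n·(cOSC²ε₁²/4·h_K² + (cSZ·cBCH·ε₁³ +
(N/24)(cSZ ε₁ + cBCH ε₁²)⁴)·(L⁻²)^K)` and the producer `interpolation_averaging_UN_profile` (generation 13's
`T4TermwiseChainUN.interpolation_averaging_UN` with the (B∇)-type law re-typed `α₁(K) ≤ c_{α1}ε₁L^{−2(K+1)}·h_K`,
`h ∈ ℓ²`); §5 the ledger theorem `goodClause_summable_UN_profile` (generation 13's `goodClause_summable_UN`, same
re-typing; every other binder BY NAME and VERBATIM).  The (L)-majorant is generation 13's `dLN`, by name.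
-/

noncomputable section

open Finset MeasureTheory _root_.Filter _root_.Topology NormedSpace
open scoped BigOperators Matrix.Norms.L2Operator InnerProductSpace

namespace Summit.QuantumFields.BalabanUV.T4Continuum.TermwiseHolder

open Literature.MathematicalPhysics.QuantumFieldTheory.Balaban1983to89
open T4OutputRate T4RecentScale T4GoodClassBudget T4CauchySum T4Crossover T4TowerRateComposition T4TowerRateDischarge
open T4BoundaryCarrier (BFunctional atFl NE9Fl LipBackgroundFl NE5B)
open T4TermwiseBudget T4TermwiseDeviation T4TermwiseCurrency T4TermwiseBoundary T4TermwiseResidual T4TermwiseAction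
open T4TermwiseClassical T4TermwiseQuartic
open T4TermwiseInstantiate (cBCH cBCH_nonneg smallness_four bchBound_four rho_le_of_decay cSZ cSZ_nonneg
  half_of_smallness size_le_of_decay)
open T4TermwiseOscillation (norm_conj_sub_conj hol_conj_osc step_osc_of_bond_osc farCorner l1_zpos_sub_farCorner_le cOSC)
open B7Prop1Explicit B7Prop2Explicit T4TermwiseBCH T4TermwiseTorus T4TermwiseUN T4TermwiseChainUN

/-! ## §4 The (U)-majorant with a profile, and the producer for `U(N)` Wilson terms -/

/-- The (U)-majorant per unit block for `U(N)` Wilson terms with oscillation profile `h`: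
`dUP N L n c_α c_{α1} ε₁ h K = n·(cOSC² ε₁² / 4 · h_K² + (cSZ·cBCH·ε₁³ + (N/24)(cSZ ε₁ + cBCH ε₁²)⁴)·(L⁻²)^K)`.
At the endpoint profile `h_K = L^{−K}` it is generation 13's `dUN` (part 4, `dUP_endpoint_eq_dUN`). [folklore] -/
def dUP (N L n : ℕ) (cα cα₁ ε₁ : ℝ) (h : ℕ → ℝ) (K : ℕ) : ℝ :=
  (n : ℝ) * (cOSC L cα₁ ^ 2 * ε₁ ^ 2 / 4 * h K ^ 2 + (cSZ L cα * cBCH L cα * ε₁ ^ 3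
    + (N : ℝ) / 24 * (cSZ L cα * ε₁ + cBCH L cα * ε₁ ^ 2) ^ 4) * (((L : ℝ) ^ 2)⁻¹) ^ K)

/-- Unfolding lemma for `dUP`. [folklore] -/
theorem dUP_def (N L n : ℕ) (cα cα₁ ε₁ : ℝ) (h : ℕ → ℝ) (K : ℕ) :
    dUP N L n cα cα₁ ε₁ h K = (n : ℝ) * (cOSC L cα₁ ^ 2 * ε₁ ^ 2 / 4 * h K ^ 2 + (cSZ L cα * cBCH L cα * ε₁ ^ 3
      + (N : ℝ) / 24 * (cSZ L cα * ε₁ + cBCH L cα * ε₁ ^ 2) ^ 4) * (((L : ℝ) ^ 2)⁻¹) ^ K) := rfl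

section Capstone

variable {n : Type*} [Fintype n] [DecidableEq n] [Nonempty n]
variable {ι : Type} {σ : Type*} [DecidableEq σ] {l₀ : ℝ} {T : ℕ → Finset σ} {Bad : ℕ → ℝ → Finset σ} {Adm : Set ι}

/-- **(U)(L) FOR `U(N)` WILSON TERMS, EVERY `N`, `ℓ²` OSCILLATION PROFILE — ONE CALL of part 1's
`interpolation_averaging_of_profile` with the data of generation 13's `T4TermwiseChainUN.interpolation_averaging_UN`
(`V = u(N)`, `e = eN`, `q₄ = N/24`, plaquette boxes/kernels of the torus tower, `s_K = 2α₀(K)`, `ω_K = 16L·α₁(K)`,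
`ρb_K = 280(320L²α₀(K))²`, `c₁ = cSZ`, `c₂ = cOSC`, `c₃ = cBCH`), whose dischargings (wt)(ker)(cnt)(tr)(bch)(sz)(osc-U)
(scal) are repeated verbatim.**  ONE binder re-typed: the (B∇)-type law is `0 ≤ α₁(K) ≤ c_{α1}ε₁L^{−2(K+1)}·h_K` for a
profile `h ∈ ℓ²` (`hα₁K`, `hh`) in place of `… ·L^{−K}`.  REMAINING hypotheses, BY NAME: `hαK`, `hA`/`hB` ((44),
unitarity, periodicity), `hAosc` ((44∇)), `hcα`, `hdecay`, `hα₁K`, `hh`, (repr) `hreprU`/`hreprL`, `hε₁`, `2 ≤ M`,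
`2 ≤ L`, genuine planes.  OUTPUT: per-term deviation bounds with the majorants `M⁴·dUP N L #planes c_α c_{α1} ε₁ h K`
(oscillation share `∝ h_K²`, the rest geometric) and `M⁴·dLN …` (generation 13's, unchanged), nonnegative and SUMMABLE.
None of the remaining analytic laws is printed as used; NE7 remains NOT PRINTED and NOT PROVED. [folklore] -/
theorem interpolation_averaging_UN_profile {Y YA : Type*} {g : ℕ → ℝ → σ → ι → YA → ℝ}
    {f₁ : ℕ → ℝ → σ → ι → Y → ℝ} {Q : ℕ → ℝ → σ → ι → Y → YA} {yA yB : ℕ → ℝ → σ → ι → Y}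
    {xA : ℕ → ℝ → σ → ι → YA}
    (M L : ℕ) (hM : 2 ≤ M) (hL : 2 ≤ L) (planes : Finset (Fin 4 × Fin 4)) (hplanes : ∀ P ∈ planes, P.1 ≠ P.2)
    (VA VB : ℕ → ℝ → σ → ι → (B7Prop1Explicit.Site 4 → Fin 4 → (Matrix n n ℂ)ˣ))
    {αK α₁K : ℕ → ℝ} {cα cα₁ ε₁ : ℝ} {h : ℕ → ℝ}
    (hαK : ∀ K, 0 ≤ αK K ∧ 20480 * (L : ℝ) ^ 2 * αK K ≤ 1)
    (hA : ∀ K t, |t| ≤ l₀ → ∀ τ ∈ T K \ Bad K t, ∀ v ∈ Adm,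
      (∀ x κ, VA K t τ v x κ ∈ unitaryUnits (Matrix n n ℂ)) ∧ IsPeriodic (M * L ^ K * L) (VA K t τ v) ∧
        ∀ (x : B7Prop1Explicit.Site 4) (κ κ' : Fin 4), κ ≠ κ' →
          ‖((hol (VA K t τ v) x (plaqWord κ κ') : (Matrix n n ℂ)ˣ) : Matrix n n ℂ) - 1‖ ≤ αK K)
    (hB : ∀ K t, |t| ≤ l₀ → ∀ τ ∈ T K \ Bad K t, ∀ v ∈ Adm,
      (∀ x κ, VB K t τ v x κ ∈ unitaryUnits (Matrix n n ℂ)) ∧ IsPeriodic (M * L ^ K * L) (VB K t τ v) ∧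
        ∀ (x : B7Prop1Explicit.Site 4) (κ κ' : Fin 4), κ ≠ κ' →
          ‖((hol (VB K t τ v) x (plaqWord κ κ') : (Matrix n n ℂ)ˣ) : Matrix n n ℂ) - 1‖ ≤ αK K)
    (hAosc : ∀ K t, |t| ≤ l₀ → ∀ τ ∈ T K \ Bad K t, ∀ v ∈ Adm, ∀ P ∈ planes,
      ∀ (z : B7Prop1Explicit.Site 4) (κ : Fin 4),
        ‖((VA K t τ v z κ : (Matrix n n ℂ)ˣ) : Matrix n n ℂ) * phiM (VA K t τ v) P (z + e κ)
            * (((VA K t τ v z κ)⁻¹ : (Matrix n n ℂ)ˣ) : Matrix n n ℂ) - phiM (VA K t τ v) P z‖ ≤ α₁K K)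
    (hcα : 0 ≤ cα) (hdecay : ∀ K, αK K ≤ cα * ε₁ * (((L : ℝ) ^ K)⁻¹) ^ 2)
    (hα₁K : ∀ K, 0 ≤ α₁K K ∧ α₁K K ≤ cα₁ * ε₁ * (((L : ℝ) ^ (K + 1))⁻¹) ^ 2 * h K)
    (hh : Summable (fun K => h K ^ 2))
    (hreprU : ∀ K t, |t| ≤ l₀ → ∀ τ ∈ T K \ Bad K t, ∀ v ∈ Adm,
      f₁ K t τ v (yA K t τ v) = ∑ x ∈ pbox planes (M * L ^ K * L), eN (phiU (VA K t τ v) x) ∧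
        g K t τ v (xA K t τ v) = ∑ y ∈ pbox planes (M * L ^ K), eN (psiU L (VA K t τ v) y))
    (hreprL : ∀ K t, |t| ≤ l₀ → ∀ τ ∈ T K \ Bad K t, ∀ v ∈ Adm,
      f₁ K t τ v (yB K t τ v) = ∑ x ∈ pbox planes (M * L ^ K * L), eN (phiU (VB K t τ v) x) ∧
        g K t τ v (Q K t τ v (yB K t τ v)) = ∑ y ∈ pbox planes (M * L ^ K), eN (psiU L (VB K t τ v) y))
    (hε₁ : 0 ≤ ε₁) :
    (∀ K t, |t| ≤ l₀ → ∀ τ ∈ T K \ Bad K t, ∀ v ∈ Adm,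
      f₁ K t τ v (yA K t τ v) - g K t τ v (xA K t τ v)
        ≤ (M : ℝ) ^ 4 * dUP (Fintype.card n) L planes.card cα cα₁ ε₁ h K) ∧
    (∀ K t, |t| ≤ l₀ → ∀ τ ∈ T K \ Bad K t, ∀ v ∈ Adm,
      g K t τ v (Q K t τ v (yB K t τ v)) - f₁ K t τ v (yB K t τ v)
        ≤ (M : ℝ) ^ 4 * dLN (Fintype.card n) L planes.card cα ε₁ K) ∧
    (∀ K, 0 ≤ dUP (Fintype.card n) L planes.card cα cα₁ ε₁ h K) ∧
    (∀ K, 0 ≤ dLN (Fintype.card n) L planes.card cα ε₁ K) ∧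
    Summable (dUP (Fintype.card n) L planes.card cα cα₁ ε₁ h) ∧
    Summable (dLN (Fintype.card n) L planes.card cα ε₁) := by
  have hM0 : 0 < M := by omega
  have hL0 : 0 < L := by omega
  have hL1 : 1 ≤ L := by omega
  have hLr : (1 : ℝ) < L := by exact_mod_cast (lt_of_lt_of_le one_lt_two hL)
  -- the torus side `M·L^K·L` is at least two blocks: `2L ≤ M·L^K·L`
  have h2L : ∀ K, 2 * L ≤ M * L ^ K * L := fun K =>
    Nat.mul_le_mul_right L (le_trans hM (Nat.le_mul_of_pos_right M (pow_pos hL0 K)))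
  have hhalf : ∀ K, αK K ≤ 1 / 2 := fun K => half_of_smallness hL1 (hαK K).2
  obtain ⟨hw, hrow, hcol, hNf, hNc⟩ := kernel_tower_geometric M L hM0 hL0 planes
  have hρ := rho_le_of_decay L (fun K => (hαK K).1) hdecay
  have hω : ∀ K, 0 ≤ 4 * ((4 : ℕ) : ℝ) * (L : ℝ) * α₁K K ∧
      4 * ((4 : ℕ) : ℝ) * (L : ℝ) * α₁K K ≤ cOSC L cα₁ * ε₁ * (((L : ℝ) ^ (K + 1))⁻¹) ^ 2 * h K :=
    fun K => ⟨by have h0 := (hα₁K K).1; positivity,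
      calc 4 * ((4 : ℕ) : ℝ) * (L : ℝ) * α₁K K = 16 * (L : ℝ) * α₁K K := by push_cast; ring
        _ ≤ 16 * (L : ℝ) * (cα₁ * ε₁ * (((L : ℝ) ^ (K + 1))⁻¹) ^ 2 * h K) :=
            mul_le_mul_of_nonneg_left (hα₁K K).2 (by positivity)
        _ = cOSC L cα₁ * ε₁ * (((L : ℝ) ^ (K + 1))⁻¹) ^ 2 * h K := by unfold cOSC; ring⟩
  obtain ⟨hU, hLd, hU0, hL0, hUs, hLs⟩ := interpolation_averaging_of_profile (V := ↥(uN n)) (e := eN)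
    (q₄ := (Fintype.card n : ℝ) / 24) (h := h) (l₀ := l₀) (T := T) (Bad := Bad) (Adm := Adm)
    (g := g) (f₁ := f₁) (Q := Q) (yA := yA) (yB := yB) (xA := xA)
    (vol := (M : ℝ) ^ 4) (n₀ := (planes.card : ℝ)) (c₁ := cSZ L cα) (c₂ := cOSC L cα₁) (c₃ := cBCH L cα)
    (s := fun K => 2 * αK K) (ω := fun K => 4 * ((4 : ℕ) : ℝ) * (L : ℝ) * α₁K K)
    (Pf := fun K => pbox planes (M * L ^ K * L)) (Pc := fun K => pbox planes (M * L ^ K))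
    (w := fun K => pker (M * L ^ K * L) L)
    (φA := fun K t τ v x => phiU (VA K t τ v) x) (ψA := fun K t τ v y => psiU L (VA K t τ v) y)
    (ΦA := fun K t τ v y x => PhiU (M * L ^ K * L) L (VA K t τ v) y x)
    (φB := fun K t τ v x => phiU (VB K t τ v) x) (ψB := fun K t τ v y => psiU L (VB K t τ v) y)
    (ΦB := fun K t τ v y x => PhiU (M * L ^ K * L) L (VB K t τ v) y x)
    (ρb := fun K => 280 * (320 * (L : ℝ) ^ 2 * αK K) ^ 2)
    eN_sandwich (by positivity) hLr hw hrow hcol (Nat.cast_nonneg _) (by positivity)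
    (fun K => (hNf K).le) (fun K => (hNc K).le) hreprU
    (fun K t ht τ hτ v hv y _ x _ => norm_PhiU _ L (hA K t ht τ hτ v hv).1 (hA K t ht τ hτ v hv).2.1 y x)
    (fun K t ht τ hτ v hv y hy =>
      bch_PhiU_four _ L planes hplanes (hA K t ht τ hτ v hv).1 hL1 (h2L K) (hαK K).1 (hαK K).2
        (hA K t ht τ hτ v hv).2.2 y (Finset.mem_product.1 hy).1)
    (fun K t ht τ hτ v hv x hx =>
      norm_phiU_le_four hL1 (hA K t ht τ hτ v hv).1 (hαK K).1 (hαK K).2 (hA K t ht τ hτ v hv).2.2 x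
        (hplanes x.1 (Finset.mem_product.1 hx).1))
    (fun K t ht τ hτ v hv y hy x _ x' _ hpos hpos' =>
      norm_PhiU_sub_PhiU (M * L ^ K * L) L (hA K t ht τ hτ v hv).1 (hα₁K K).1 y x x'
        (hplanes y.1 (Finset.mem_product.1 hy).1)
        (step_osc_of_bond_osc (U1_of_U (hA K t ht τ hτ v hv).1) (phiM (VA K t τ v) y.1)
          (hAosc K t ht τ hτ v hv y.1 (Finset.mem_product.1 hy).1)) hpos hpos')
    hreprL
    (fun K t ht τ hτ v hv y _ x _ => norm_PhiU _ L (hB K t ht τ hτ v hv).1 (hB K t ht τ hτ v hv).2.1 y x)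
    (fun K t ht τ hτ v hv y hy =>
      bch_PhiU_four _ L planes hplanes (hB K t ht τ hτ v hv).1 hL1 (h2L K) (hαK K).1 (hαK K).2
        (hB K t ht τ hτ v hv).2.2 y (Finset.mem_product.1 hy).1)
    (fun K t ht τ hτ v hv x hx =>
      norm_phiU_le_four hL1 (hB K t ht τ hτ v hv).1 (hαK K).1 (hαK K).2 (hB K t ht τ hτ v hv).2.2 x
        (hplanes x.1 (Finset.mem_product.1 hx).1))
    (cSZ_nonneg L hcα) (cBCH_nonneg L cα) hε₁ (size_le_of_decay L hL1 (fun K => (hαK K).1) hdecay) hω hh hρ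
  exact ⟨hU, hLd, hU0, hL0, hUs, hLs⟩


end Capstone

/-! ## §5 The good-class half with `Summable δ⁗` for G = U(N) Wilson terms, `ℓ²` oscillation profile -/

section Ledger

variable {n : Type*} [Fintype n] [DecidableEq n] [Nonempty n]
variable {C : T4BoundaryCarrier.Carriers} {ι : Type} [MeasurableSpace ι] {σ : Type*} [DecidableEq σ] {l₀ vol : ℝ}
  {T : ℕ → Finset σ} {Bad : ℕ → ℝ → Finset σ} {A B : ℕ → ℝ → σ → ℝ} {μ : ℕ → ℝ → σ → Measure ι}
  {fac bfac rfac : ℕ → ℝ → σ → Finset C.Dom} {Adm : Set ι} {EA : Functional C.toCarriers C.BgA}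
  {EB : Functional C.toCarriers C.BgB} {BA : BFunctional C C.BgA} {BB : BFunctional C C.BgB}
  {RA : Functional C.toCarriers C.BgA} {RB : Functional C.toCarriers C.BgB}
  {κ θ' Cr EB₀ CrR R₁ b β' w₀ : ℝ} {κ₀ : ℕ} {gA gB : ℕ → ℕ → ℝ} {gfA gfB : ℕ → ℝ} {gsA gsB : ℕ → ℕ → ℝ}
  {uA : ℕ → ι → C.BgA} {uB : ℕ → ι → C.BgB} {oneA : C.BgA} {oneB : C.BgB}
  {pend : ℕ → ℝ → σ → ι → C.Fl} {nA nB aA aB wA wB γA γB : ℕ → ℝ → σ → ι → ℝ} {qA qB : ℕ → ℝ}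
  {κ₁ S : ℕ → ℝ → σ → ℕ → ℝ} {cW RW : ℕ → ℝ → σ → ℝ} {rw sw rγ zA zB c₀ : ℕ → ℝ} {Cw E a Λ Cl : ℝ}

/-- **THE GOOD-CLASS HALF WITH `Summable δ⁗` FOR G = U(N) WILSON TERMS, `ℓ²` OSCILLATION PROFILE: generation 9's
`goodClause_summable_of_kindsRA_lift` with (U) `hUdev hdU0 hdU` and (L) `hLdev hdL0 hdL` SUPPLIED by
`interpolation_averaging_UN_profile`.**  Every other ledger binder of generation 13's `goodClause_summable_UN` is
carried BY NAME and VERBATIM (none discharged) — the flow window (0.31) of [Balaban1987RG1] sits in `h031A`/`h031B`;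
(repr) `hreprU hreprL`, (44) `hA hB`, (44∇) `hAosc`, the smallness `hαK`, the decay laws `hdecay` ((B)-type INPUT)
and `hα₁K` ((B∇)-type INPUT, now with the profile factor `h_K`, `h ∈ ℓ²` by `hh`), `hcα hε₁`, `2 ≤ M`, `2 ≤ L`,
genuine planes and `hMvol : M⁴ ≤ vol` are hypotheses.  OUTPUT: the good clause with `δ⁗` whose action-kind share
is `w₀·(dUP N … h K + dLN N … K)`, `N = Fintype.card n`, and `Summable δ⁗`.  No print is quoted; nothing printed is
asserted; NOT NE7, NOT Clay. [folklore] -/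
theorem goodClause_summable_UN_profile {Y YA : Type*} {Sfib : ℕ → ℝ → σ → ι → Set Y}
    {SfibA : ℕ → ℝ → σ → ι → Set YA} {g : ℕ → ℝ → σ → ι → YA → ℝ} {f₁ : ℕ → ℝ → σ → ι → Y → ℝ}
    {Q : ℕ → ℝ → σ → ι → Y → YA} {yA yB : ℕ → ℝ → σ → ι → Y} {xA : ℕ → ℝ → σ → ι → YA}
    (M L : ℕ) (hMtwo : 2 ≤ M) (hLtwo : 2 ≤ L) (planes : Finset (Fin 4 × Fin 4))
    (hplanes : ∀ P ∈ planes, P.1 ≠ P.2)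
    (VA VB : ℕ → ℝ → σ → ι → (B7Prop1Explicit.Site 4 → Fin 4 → (Matrix n n ℂ)ˣ))
    {αK α₁K : ℕ → ℝ} {cα cα₁ ε₁ : ℝ} {h : ℕ → ℝ}
    (hUR : ∀ K, URateUpTo K EA EB (gA K) (gB K) (uA K) (uB K) Adm Cr θ' κ) (hCr : 0 ≤ Cr)
    (hθ'0 : 0 < θ') (hθ'1 : θ' < 1) (hθ'Λ : θ' ≤ Λ) (hΛ1 : 1 ≤ Λ) (hCl : 0 ≤ Cl)
    (hURB : ∀ b ∈ C.admFl, ∀ K, URateUpTo K (atFl BA b) (atFl BB b) (gA K) (gB K) (uA K) (uB K) Adm EB₀ θ' κ)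
    (hEB₀ : 0 ≤ EB₀)
    (hURR : ∀ K, URateUpTo K RA RB (gA K) (gB K) (uA K) (uB K) Adm CrR θ' κ) (hCrR : 0 ≤ CrR)
    (hfmtA : ∀ K t τ, A K t τ = ∫ v, (∏ X ∈ fac K t τ,
      Real.exp (EA (gA K) (uA K v) X - EA (gA K) oneA X)) *
        ((∏ X ∈ bfac K t τ, Real.exp (BA (gA K) (uA K v) (pend K t τ v) X)) * nA K t τ v * qA K *
          ((∏ X ∈ rfac K t τ, Real.exp (RA (gA K) (uA K v) X - RA (gA K) oneA X)) * (Real.exp (-aA K t τ v) * wA K t τ v)))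
          ∂(μ K t τ))
    (hfmtB : ∀ K t τ, B K t τ = ∫ v, (∏ X ∈ fac K t τ,
      Real.exp (EB (gB K) (uB K v) X - EB (gB K) oneB X)) *
        ((∏ X ∈ bfac K t τ, Real.exp (BB (gB K) (uB K v) (pend K t τ v) X)) * nB K t τ v * qB K *
          ((∏ X ∈ rfac K t τ, Real.exp (RB (gB K) (uB K v) X - RB (gB K) oneB X)) * (Real.exp (-aB K t τ v) * wB K t τ v)))
          ∂(μ K t τ))
    (hint : ∀ K t, |t| ≤ l₀ → ∀ τ ∈ T K \ Bad K t,
      Integrable (fun v => (∏ X ∈ fac K t τ, Real.exp (EA (gA K) (uA K v) X - EA (gA K) oneA X)) *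
        ((∏ X ∈ bfac K t τ, Real.exp (BA (gA K) (uA K v) (pend K t τ v) X)) * nA K t τ v * qA K *
          ((∏ X ∈ rfac K t τ, Real.exp (RA (gA K) (uA K v) X - RA (gA K) oneA X)) * (Real.exp (-aA K t τ v) * wA K t τ v))))
          (μ K t τ) ∧
      Integrable (fun v => (∏ X ∈ fac K t τ, Real.exp (EB (gB K) (uB K v) X - EB (gB K) oneB X)) *
        ((∏ X ∈ bfac K t τ, Real.exp (BB (gB K) (uB K v) (pend K t τ v) X)) * nB K t τ v * qB K *
          ((∏ X ∈ rfac K t τ, Real.exp (RB (gB K) (uB K v) X - RB (gB K) oneB X)) * (Real.exp (-aB K t τ v) * wB K t τ v))))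
          (μ K t τ))
    (hsc : ∀ K t, |t| ≤ l₀ → ∀ τ ∈ T K \ Bad K t, ∀ X ∈ fac K t τ, C.scale X ≤ K)
    (hoff : ∀ K t, |t| ≤ l₀ → ∀ τ ∈ T K \ Bad K t, ∀ v, v ∉ Adm →
      (∏ X ∈ fac K t τ, Real.exp (EA (gA K) (uA K v) X - EA (gA K) oneA X)) *
        ((∏ X ∈ bfac K t τ, Real.exp (BA (gA K) (uA K v) (pend K t τ v) X)) * nA K t τ v * qA K *
          ((∏ X ∈ rfac K t τ, Real.exp (RA (gA K) (uA K v) X - RA (gA K) oneA X)) * (Real.exp (-aA K t τ v) * wA K t τ v)))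
          = 0 ∧
      (∏ X ∈ fac K t τ, Real.exp (EB (gB K) (uB K v) X - EB (gB K) oneB X)) *
        ((∏ X ∈ bfac K t τ, Real.exp (BB (gB K) (uB K v) (pend K t τ v) X)) * nB K t τ v * qB K *
          ((∏ X ∈ rfac K t τ, Real.exp (RB (gB K) (uB K v) X - RB (gB K) oneB X)) * (Real.exp (-aB K t τ v) * wB K t τ v)))
          = 0)
    (hS : ∀ K t, |t| ≤ l₀ → ∀ τ ∈ T K \ Bad K t, ∀ v ∈ Adm, ∀ j ≤ K,
      |(∑ X ∈ fac K t τ with C.scale X = j,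
          (Real.log (Real.exp (EB (gB K) (uB K v) X - EB (gB K) oneB X))
            - Real.log (Real.exp (EA (gA K) (uA K v) X - EA (gA K) oneA X)))) - κ₁ K t τ j| ≤ S K t τ j)
    (hM : ∀ K t, |t| ≤ l₀ → ∀ τ ∈ T K \ Bad K t,
      Multiplicity (fac K t τ) C.scale (fun X => Real.exp (-(κ * C.d X))) Cw vol Λ K)
    (hwit : ∀ K, ∃ v₁ ∈ Adm, uA K v₁ = oneA ∧ uB K v₁ = oneB)
    (hvol : 0 ≤ vol) (hE : 0 ≤ E) (ha0 : 0 < a) (ha1 : a < 1)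
    (hSle : ∀ K t, |t| ≤ l₀ → ∀ τ ∈ T K \ Bad K t, ∀ j ≤ K, S K t τ j ≤ vol * (E * a ^ (K - j)))
    (hpend : ∀ K t, |t| ≤ l₀ → ∀ τ ∈ T K \ Bad K t, ∀ v ∈ Adm, pend K t τ v ∈ C.admFl)
    (hBwin : ∀ K t, |t| ≤ l₀ → ∀ τ ∈ T K \ Bad K t, RecentOnly (bfac K t τ) C.scale (jlogOf Cl K) K)
    (hMB : ∀ K t, |t| ≤ l₀ → ∀ τ ∈ T K \ Bad K t,
      Multiplicity (bfac K t τ) C.scale (fun X => Real.exp (-(κ * C.d X))) Cw vol Λ K)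
    (hnpos : ∀ K t, |t| ≤ l₀ → ∀ τ ∈ T K \ Bad K t, ∀ v ∈ Adm, 0 < nA K t τ v ∧ 0 < nB K t τ v)
    (hzA : ∀ K t, |t| ≤ l₀ → ∀ τ ∈ T K \ Bad K t, ∀ v ∈ Adm, |Real.log (nA K t τ v)| ≤ vol * zA K)
    (hzB : ∀ K t, |t| ≤ l₀ → ∀ τ ∈ T K \ Bad K t, ∀ v ∈ Adm, |Real.log (nB K t τ v)| ≤ vol * zB K)
    (hzAs : Summable zA) (hzBs : Summable zB)
    (hq : ∀ K, 0 < qA K ∧ 0 < qB K)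
    -- the 𝐑-kind: scales, multiplicity, one-run slice sizes, the flow window of both coupling tables
    (hrsc : ∀ K t, |t| ≤ l₀ → ∀ τ ∈ T K \ Bad K t, ∀ X ∈ rfac K t τ, C.scale X ≤ K)
    (hMR : ∀ K t, |t| ≤ l₀ → ∀ τ ∈ T K \ Bad K t,
      Multiplicity (rfac K t τ) C.scale (fun X => Real.exp (-(κ * C.d X))) Cw vol Λ K)
    (hRSA : ∀ K t, |t| ≤ l₀ → ∀ τ ∈ T K \ Bad K t, ∀ v ∈ Adm, ∀ j ≤ K,
      |∑ X ∈ rfac K t τ with C.scale X = j, (RA (gA K) (uA K v) X - RA (gA K) oneA X)| ≤ vol * (R₁ * gsA K j ^ κ₀))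
    (hRSB : ∀ K t, |t| ≤ l₀ → ∀ τ ∈ T K \ Bad K t, ∀ v ∈ Adm, ∀ j ≤ K,
      |∑ X ∈ rfac K t τ with C.scale X = j, (RB (gB K) (uB K v) X - RB (gB K) oneB X)| ≤ vol * (R₁ * gsB K j ^ κ₀))
    (hb : 0 < b) (h031A : ∀ K, Step.Discrete031 b β' K (gfA K) (gsA K))
    (h031B : ∀ K, Step.Discrete031 b β' K (gfB K) (gsB K)) (hgsA : ∀ K k, k ≤ K → 0 ≤ gsA K k)
    (hgsB : ∀ K k, k ≤ K → 0 ≤ gsB K k) (hR₁ : 0 ≤ R₁) (hκ₀ : 4 < κ₀)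
    -- the ACTION kind from ONE CLASSICAL STEP: (min-A) (Q) (lift) (min-B) (act) (U) (L) (γ)
    (hminA : ∀ K t, |t| ≤ l₀ → ∀ τ ∈ T K \ Bad K t, ∀ v ∈ Adm, IsMinOn (g K t τ v) (SfibA K t τ v) (xA K t τ v))
    (hQ : ∀ K t, |t| ≤ l₀ → ∀ τ ∈ T K \ Bad K t, ∀ v ∈ Adm, Set.MapsTo (Q K t τ v) (Sfib K t τ v) (SfibA K t τ v))
    (hlift : ∀ K t, |t| ≤ l₀ → ∀ τ ∈ T K \ Bad K t, ∀ v ∈ Adm,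
      yA K t τ v ∈ Sfib K t τ v ∧ Q K t τ v (yA K t τ v) = xA K t τ v)
    (hminB : ∀ K t, |t| ≤ l₀ → ∀ τ ∈ T K \ Bad K t, ∀ v ∈ Adm,
      yB K t τ v ∈ Sfib K t τ v ∧ IsMinOn (f₁ K t τ v) (Sfib K t τ v) (yB K t τ v))
    (hact : ∀ K t, |t| ≤ l₀ → ∀ τ ∈ T K \ Bad K t, ∀ v ∈ Adm,
      aA K t τ v = w₀ * g K t τ v (xA K t τ v) + γA K t τ v ∧
        aB K t τ v = w₀ * f₁ K t τ v (yB K t τ v) + γB K t τ v)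
    (hw₀ : 0 ≤ w₀)
    -- (U)(L) PRODUCED for G = U(N) Wilson terms (`interpolation_averaging_UN`): (repr) `hreprU hreprL`, (44) `hA hB`,
    -- (44∇) `hAosc`, smallness `hαK`, decays `hdecay` `hα₁K`, `hcα hε₁`, and `M⁴ ≤ vol`
    (hαK : ∀ K, 0 ≤ αK K ∧ 20480 * (L : ℝ) ^ 2 * αK K ≤ 1)
    (hA : ∀ K t, |t| ≤ l₀ → ∀ τ ∈ T K \ Bad K t, ∀ v ∈ Adm,
      (∀ x κ, VA K t τ v x κ ∈ unitaryUnits (Matrix n n ℂ)) ∧ IsPeriodic (M * L ^ K * L) (VA K t τ v) ∧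
        ∀ (x : B7Prop1Explicit.Site 4) (κ κ' : Fin 4), κ ≠ κ' →
          ‖((hol (VA K t τ v) x (plaqWord κ κ') : (Matrix n n ℂ)ˣ) : Matrix n n ℂ) - 1‖ ≤ αK K)
    (hB : ∀ K t, |t| ≤ l₀ → ∀ τ ∈ T K \ Bad K t, ∀ v ∈ Adm,
      (∀ x κ, VB K t τ v x κ ∈ unitaryUnits (Matrix n n ℂ)) ∧ IsPeriodic (M * L ^ K * L) (VB K t τ v) ∧
        ∀ (x : B7Prop1Explicit.Site 4) (κ κ' : Fin 4), κ ≠ κ' →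
          ‖((hol (VB K t τ v) x (plaqWord κ κ') : (Matrix n n ℂ)ˣ) : Matrix n n ℂ) - 1‖ ≤ αK K)
    (hAosc : ∀ K t, |t| ≤ l₀ → ∀ τ ∈ T K \ Bad K t, ∀ v ∈ Adm, ∀ P ∈ planes,
      ∀ (z : B7Prop1Explicit.Site 4) (κ : Fin 4),
        ‖((VA K t τ v z κ : (Matrix n n ℂ)ˣ) : Matrix n n ℂ) * phiM (VA K t τ v) P (z + e κ)
            * (((VA K t τ v z κ)⁻¹ : (Matrix n n ℂ)ˣ) : Matrix n n ℂ) - phiM (VA K t τ v) P z‖ ≤ α₁K K)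
    (hcα : 0 ≤ cα) (hdecay : ∀ K, αK K ≤ cα * ε₁ * (((L : ℝ) ^ K)⁻¹) ^ 2)
    (hα₁K : ∀ K, 0 ≤ α₁K K ∧ α₁K K ≤ cα₁ * ε₁ * (((L : ℝ) ^ (K + 1))⁻¹) ^ 2 * h K)
    (hh : Summable (fun K => h K ^ 2))
    (hreprU : ∀ K t, |t| ≤ l₀ → ∀ τ ∈ T K \ Bad K t, ∀ v ∈ Adm,
      f₁ K t τ v (yA K t τ v) = ∑ x ∈ pbox planes (M * L ^ K * L), eN (phiU (VA K t τ v) x) ∧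
        g K t τ v (xA K t τ v) = ∑ y ∈ pbox planes (M * L ^ K), eN (psiU L (VA K t τ v) y))
    (hreprL : ∀ K t, |t| ≤ l₀ → ∀ τ ∈ T K \ Bad K t, ∀ v ∈ Adm,
      f₁ K t τ v (yB K t τ v) = ∑ x ∈ pbox planes (M * L ^ K * L), eN (phiU (VB K t τ v) x) ∧
        g K t τ v (Q K t τ v (yB K t τ v)) = ∑ y ∈ pbox planes (M * L ^ K), eN (psiU L (VB K t τ v) y))
    (hε₁ : 0 ≤ ε₁) (hMvol : ((M : ℝ)) ^ 4 ≤ vol)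
    (hγ : ∀ K t, |t| ≤ l₀ → ∀ τ ∈ T K \ Bad K t, ∀ v ∈ Adm, |γB K t τ v - γA K t τ v| ≤ vol * rγ K)
    (hrγ : Summable rγ)
    -- the residual kind after generation 8: (R-w) radii about a centre `cW`, (W-w) the WITNESS log-ratio centred
    (hwpos : ∀ K t, |t| ≤ l₀ → ∀ τ ∈ T K \ Bad K t, ∀ v ∈ Adm, 0 < wA K t τ v ∧ 0 < wB K t τ v)
    (hRw : ∀ K t, |t| ≤ l₀ → ∀ τ ∈ T K \ Bad K t, ∀ v ∈ Adm,
      |Real.log (wB K t τ v) - Real.log (wA K t τ v) - cW K t τ| ≤ RW K t τ)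
    (hRRw : ∀ K t, |t| ≤ l₀ → ∀ τ ∈ T K \ Bad K t, RW K t τ ≤ vol * rw K) (hrw : Summable rw)
    (hWw : ∀ K t, |t| ≤ l₀ → ∀ τ ∈ T K \ Bad K t, ∀ v ∈ Adm, uA K v = oneA → uB K v = oneB →
      |Real.log (wB K t τ v) - Real.log (wA K t τ v) - c₀ K| ≤ vol * sw K)
    (hsw : Summable sw) :
    GoodClause l₀ vol T A B Bad
        (fun K => (max Cw 1 * ((E + Cr) * ∑ x ∈ antidiagonal K, min (a ^ x.2) (θ' ^ x.1 * Λ ^ x.2))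
            + (EB₀ * Cw * windowSum θ' Λ (jlogOf Cl K) K + (zA K + zB K)
              + (max (2 * Cw) 1 * ((∑ p ∈ antidiagonal K, min (R₁ * gsA K p.1 ^ κ₀) (CrR * θ' ^ p.1 * Λ ^ p.2))
                  + ∑ p ∈ antidiagonal K, min (R₁ * gsB K p.1 ^ κ₀) (CrR * θ' ^ p.1 * Λ ^ p.2))
                + (w₀ * (dUP (Fintype.card n) L planes.card cα cα₁ ε₁ h K + dLN (Fintype.card n) L planes.card cα ε₁ K)
                  + rγ K + rw K))))
          + (max Cw 1 * ((E + Cr) * ∑ x ∈ antidiagonal K, min (a ^ x.2) (θ' ^ x.1 * Λ ^ x.2)) + (rw K + sw K))) ∧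
      Summable (fun K => (max Cw 1 * ((E + Cr) * ∑ x ∈ antidiagonal K, min (a ^ x.2) (θ' ^ x.1 * Λ ^ x.2))
            + (EB₀ * Cw * windowSum θ' Λ (jlogOf Cl K) K + (zA K + zB K)
              + (max (2 * Cw) 1 * ((∑ p ∈ antidiagonal K, min (R₁ * gsA K p.1 ^ κ₀) (CrR * θ' ^ p.1 * Λ ^ p.2))
                  + ∑ p ∈ antidiagonal K, min (R₁ * gsB K p.1 ^ κ₀) (CrR * θ' ^ p.1 * Λ ^ p.2))
                + (w₀ * (dUP (Fintype.card n) L planes.card cα cα₁ ε₁ h K + dLN (Fintype.card n) L planes.card cα ε₁ K)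
                  + rγ K + rw K))))
          + (max Cw 1 * ((E + Cr) * ∑ x ∈ antidiagonal K, min (a ^ x.2) (θ' ^ x.1 * Λ ^ x.2)) + (rw K + sw K))) := by
  obtain ⟨hU, hLd, hU0, hL0, hUs, hLs⟩ := interpolation_averaging_UN_profile (g := g) (f₁ := f₁) (Q := Q) (yA := yA)
    (yB := yB) (xA := xA) M L hMtwo hLtwo planes hplanes VA VB hαK hA hB hAosc hcα hdecay hα₁K hh hreprU hreprL hε₁
  have hUdev : ∀ K t, |t| ≤ l₀ → ∀ τ ∈ T K \ Bad K t, ∀ v ∈ Adm,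
      f₁ K t τ v (yA K t τ v) - g K t τ v (xA K t τ v) ≤ vol * dUP (Fintype.card n) L planes.card cα cα₁ ε₁ h K :=
    fun K t ht τ hτ v hv => (hU K t ht τ hτ v hv).trans (mul_le_mul_of_nonneg_right hMvol (hU0 K))
  have hLdev : ∀ K t, |t| ≤ l₀ → ∀ τ ∈ T K \ Bad K t, ∀ v ∈ Adm,
      g K t τ v (Q K t τ v (yB K t τ v)) - f₁ K t τ v (yB K t τ v) ≤ vol * dLN (Fintype.card n) L planes.card cα ε₁ K :=
    fun K t ht τ hτ v hv => (hLd K t ht τ hτ v hv).trans (mul_le_mul_of_nonneg_right hMvol (hL0 K))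
  exact goodClause_summable_of_kindsRA_lift hUR hCr hθ'0 hθ'1 hθ'Λ hΛ1 hCl hURB hEB₀ hURR hCrR hfmtA hfmtB hint hsc
    hoff hS hM hwit hvol hE ha0 ha1 hSle hpend hBwin hMB hnpos hzA hzB hzAs hzBs hq hrsc hMR hRSA hRSB hb h031A h031B
    hgsA hgsB hR₁ hκ₀ hminA hQ hlift hminB hact hw₀ hUdev hLdev hU0 hL0 hUs hLs hγ hrγ hwpos hRw hRRw hrw hWw hsw

end Ledger

end Summit.QuantumFields.BalabanUV.T4Continuum.TermwiseHolder
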